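import Mathlib
import Summits.Ventures.LatticeQCDFlow.TrivializingMaps.FlowLightCone
import HarnessLib

/-!
HONEST FRAMING: exact (Metropolis-corrected) sampling algorithms for lattice gauge theory; figures
of merit are autocorrelation/cost numbers at stated couplings and volumes; no continuum-physics
claim.

# FlowLightConeWindow — THEOREM L for flow-defined maps, FLOW-TIME WINDOW form (THEORY-1.md §26.8)

`TrivializingMaps/FlowLightCone.lean` (theory-1 row 78) proves the light cone of the flow map `Φ` of a
strictly local generator `Z` on `SU(n)^E` (`IsFlowMap.lightCone`) under a sup-Lipschitz modulus `K_Z`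
and a sup bound `M_Z` of `Z_t(·)_e` required for ALL `t : ℝ`. The generators of the samplers of record
(S3/S4) are Lüscher's order-`N` TRUNCATED generators `Z_t = -∂S̃^{[N]}_{β,t}`, whose sup and Lipschitz
bounds are polynomials in `|t|` of degree `N`, `N + 1` (tree `TruncatedGeneratorSupBound`,
`GradedMixedDerivBounds`) — unbounded in `t`. This file gives the COMPOSABLE form:

* `IsFlowMap.lightConeOn` — the same conclusion
  `‖Φ_t(V)_e - Φ_t(V')_e‖_F ≤ 2n · e^{Kt}(Kt)^{lvl e}/(lvl e)!`, `K = n K_Z + M_Z`, for `t ∈ [0, T]`, with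
  `K_Z`, `M_Z` asked only on the flow-time window `t ∈ [0, T)`;
* `IsFlowMap.lightConeOn_level_mono` — the uniform reading outside the cone: for `Kt ≤ 1` every link of
  level `≥ m` moves by at most `2n · e^{Kt}(Kt)^m/m!`.

Proof: verbatim the row-78 argument (`IsFlowLine.lightCone` only ever evaluates the modulus at
`t ∈ [0, T)`). No definitions. [ours; cf. Luscher2010Trivializing §3.2, §4.5(b); Raz–Sims, J. Stat. Phys.
137 (2009) 79 (arXiv:0902.0025) Thm. 1 for the mechanism]
-/

namespace Summit.Ventures.LatticeQCDFlow.TrivializingMaps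

open Literature.MathematicalPhysics.QuantumFieldTheory
open Literature.MathematicalPhysics.QuantumFieldTheory.Luscher2010
open Literature.MathematicalPhysics.QuantumFieldTheory.WilsonFlow (coeConfig)
open scoped Matrix Matrix.Norms.Frobenius Nat

variable {d L n : ℕ} [NeZero L]

/-- **LIGHT CONE FOR THE FLOW-DEFINED MAP, FLOW-TIME WINDOW FORM** (the composable form; THEORY-1 §26.8).
The same conclusion as `IsFlowMap.lightCone`, but the sup-Lipschitz modulus `K_Z` and the sup bound `M_Z`
of the generator are required only for flow times `t ∈ [0, T)` — the form a TRUNCATED generator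
`Z_t = -∂S̃^{[N]}_t` can feed, whose bounds are polynomials in `|t|` of degree `N + 1`, `N` (tree
`GradedMixedDerivBounds`, `TruncatedGeneratorSupBound`): for two initial fields `V, V'` agreeing at every
link of level `≥ 1` and all `t ∈ [0, T]`,
`‖Φ_t(V)_e - Φ_t(V')_e‖_F ≤ 2n · e^{Kt} (Kt)^{lvl e}/(lvl e)!` with `K = n K_Z + M_Z`.
`IsFlowMap.lightCone` is the special case of time-independent hypotheses. [ours; cf.
Luscher2010Trivializing §3.2, §4.5(b)] -/
theorem IsFlowMap.lightConeOn {Z : Generator d L n}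
    {Φ : ℝ → GaugeConfig d L (Matrix.specialUnitaryGroup (Fin n) ℂ) →
      GaugeConfig d L (Matrix.specialUnitaryGroup (Fin n) ℂ)}
    (hΦ : IsFlowMap Z Φ) (N : Edge d L → Set (Edge d L)) (hN : ∀ e, e ∈ N e) (lvl : Edge d L → ℕ)
    (hlvl : ∀ e, ∀ e' ∈ N e, lvl e ≤ lvl e' + 1) {KZ MZ : ℝ} (hKZ : 0 ≤ KZ) (hMZ : 0 ≤ MZ) (T : ℝ)
    (hZlip : ∀ t ∈ Set.Ico 0 T, ∀ (U U' : GaugeConfig d L (Matrix.specialUnitaryGroup (Fin n) ℂ))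
      (e : Edge d L) (M : ℝ), 0 ≤ M → (∀ e' ∈ N e, ‖coeConfig U e' - coeConfig U' e'‖ ≤ M) →
      ‖Z t (coeConfig U) e - Z t (coeConfig U') e‖ ≤ KZ * M)
    (hZbd : ∀ t ∈ Set.Ico 0 T, ∀ (U : GaugeConfig d L (Matrix.specialUnitaryGroup (Fin n) ℂ))
      (e : Edge d L), ‖Z t (coeConfig U) e‖ ≤ MZ)
    (V V' : GaugeConfig d L (Matrix.specialUnitaryGroup (Fin n) ℂ))
    (hVV' : ∀ e, 1 ≤ lvl e → V e = V' e) :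
    ∀ t ∈ Set.Icc 0 T, ∀ e, ‖coeConfig (Φ t V) e - coeConfig (Φ t V') e‖ ≤
      2 * n * Real.exp ((n * KZ + MZ) * t) * ((n * KZ + MZ) * t) ^ (lvl e) / ((lvl e)! : ℝ) := by
  have hK : 0 ≤ (n : ℝ) * KZ + MZ := by positivity
  have hδ : (0 : ℝ) ≤ 2 * n := by positivity
  have hle : ∀ (U : GaugeConfig d L (Matrix.specialUnitaryGroup (Fin n) ℂ)) (e : Edge d L),
      ‖coeConfig U e‖ ≤ n := fun U e => by
    rw [WilsonFlow.coeConfig_apply]; exact frobenius_norm_coe_SU_le (U e)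
  refine IsFlowLine.lightCone (hΦ.2 V) (hΦ.2 V') hK hδ N lvl hlvl ?_ ?_ ?_
  · intro t ht e M hM hNe
    have h1 : ‖Z t (coeConfig (Φ t V)) e - Z t (coeConfig (Φ t V')) e‖ ≤ KZ * M :=
      hZlip t ht (Φ t V) (Φ t V') e M hM hNe
    have h2 : ‖Z t (coeConfig (Φ t V')) e‖ ≤ MZ := hZbd t ht (Φ t V') e
    have h3 : ‖coeConfig (Φ t V) e‖ ≤ n := hle (Φ t V) e
    have h4 : ‖coeConfig (Φ t V) e - coeConfig (Φ t V') e‖ ≤ M := hNe e (hN e)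
    have hsplit : Z t (coeConfig (Φ t V)) e * coeConfig (Φ t V) e
        - Z t (coeConfig (Φ t V')) e * coeConfig (Φ t V') e
        = (Z t (coeConfig (Φ t V)) e - Z t (coeConfig (Φ t V')) e) * coeConfig (Φ t V) e
          + Z t (coeConfig (Φ t V')) e * (coeConfig (Φ t V) e - coeConfig (Φ t V') e) := by
      rw [sub_mul, mul_sub]; abel
    rw [hsplit]
    calc ‖(Z t (coeConfig (Φ t V)) e - Z t (coeConfig (Φ t V')) e) * coeConfig (Φ t V) e
          + Z t (coeConfig (Φ t V')) e * (coeConfig (Φ t V) e - coeConfig (Φ t V') e)‖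
        ≤ ‖Z t (coeConfig (Φ t V)) e - Z t (coeConfig (Φ t V')) e‖ * ‖coeConfig (Φ t V) e‖
          + ‖Z t (coeConfig (Φ t V')) e‖ * ‖coeConfig (Φ t V) e - coeConfig (Φ t V') e‖ :=
          (norm_add_le _ _).trans (add_le_add (norm_mul_le _ _) (norm_mul_le _ _))
      _ ≤ KZ * M * n + MZ * M := by
          gcongr
      _ = (n * KZ + MZ) * M := by ring
  · intro e
    calc ‖coeConfig (Φ 0 V) e - coeConfig (Φ 0 V') e‖
        ≤ ‖coeConfig (Φ 0 V) e‖ + ‖coeConfig (Φ 0 V') e‖ := norm_sub_le _ _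
      _ ≤ n + n := add_le_add (hle _ e) (hle _ e)
      _ = 2 * n := by ring
  · intro e he
    rw [hΦ.1 V, hΦ.1 V', WilsonFlow.coeConfig_apply, WilsonFlow.coeConfig_apply, hVV' e he]

/-- **Uniform form outside the cone** (window hypotheses): for `t ∈ [0, T]` with `Kt ≤ 1`
(`K = n K_Z + M_Z`) every link of level `≥ m` moves by at most `2n · e^{Kt}(Kt)^m/m!` under a
modification of the input field at level-`0` links. [ours] -/
theorem IsFlowMap.lightConeOn_level_mono {Z : Generator d L n}
    {Φ : ℝ → GaugeConfig d L (Matrix.specialUnitaryGroup (Fin n) ℂ) →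
      GaugeConfig d L (Matrix.specialUnitaryGroup (Fin n) ℂ)}
    (hΦ : IsFlowMap Z Φ) (N : Edge d L → Set (Edge d L)) (hN : ∀ e, e ∈ N e) (lvl : Edge d L → ℕ)
    (hlvl : ∀ e, ∀ e' ∈ N e, lvl e ≤ lvl e' + 1) {KZ MZ : ℝ} (hKZ : 0 ≤ KZ) (hMZ : 0 ≤ MZ) (T : ℝ)
    (hZlip : ∀ t ∈ Set.Ico 0 T, ∀ (U U' : GaugeConfig d L (Matrix.specialUnitaryGroup (Fin n) ℂ))
      (e : Edge d L) (M : ℝ), 0 ≤ M → (∀ e' ∈ N e, ‖coeConfig U e' - coeConfig U' e'‖ ≤ M) →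
      ‖Z t (coeConfig U) e - Z t (coeConfig U') e‖ ≤ KZ * M)
    (hZbd : ∀ t ∈ Set.Ico 0 T, ∀ (U : GaugeConfig d L (Matrix.specialUnitaryGroup (Fin n) ℂ))
      (e : Edge d L), ‖Z t (coeConfig U) e‖ ≤ MZ)
    (V V' : GaugeConfig d L (Matrix.specialUnitaryGroup (Fin n) ℂ))
    (hVV' : ∀ e, 1 ≤ lvl e → V e = V' e) {t : ℝ} (ht : t ∈ Set.Icc 0 T)
    (hKt : ((n : ℝ) * KZ + MZ) * t ≤ 1) (m : ℕ) (e : Edge d L) (hm : m ≤ lvl e) :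
    ‖coeConfig (Φ t V) e - coeConfig (Φ t V') e‖ ≤
      2 * n * Real.exp ((n * KZ + MZ) * t) * ((n * KZ + MZ) * t) ^ m / (m ! : ℝ) := by
  have hK : 0 ≤ (n : ℝ) * KZ + MZ := by positivity
  have hKt0 : 0 ≤ ((n : ℝ) * KZ + MZ) * t := mul_nonneg hK ht.1
  refine (IsFlowMap.lightConeOn hΦ N hN lvl hlvl hKZ hMZ T hZlip hZbd V V' hVV' t ht e).trans ?_
  have hA : 0 ≤ 2 * (n : ℝ) * Real.exp ((n * KZ + MZ) * t) := by positivity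
  rw [mul_div_assoc, mul_div_assoc]
  refine mul_le_mul_of_nonneg_left ?_ hA
  rw [div_le_div_iff₀ (by positivity) (by positivity)]
  calc (((n : ℝ) * KZ + MZ) * t) ^ lvl e * (m ! : ℝ)
      ≤ (((n : ℝ) * KZ + MZ) * t) ^ m * (m ! : ℝ) :=
        mul_le_mul_of_nonneg_right (pow_le_pow_of_le_one hKt0 hKt hm) (by positivity)
    _ ≤ (((n : ℝ) * KZ + MZ) * t) ^ m * ((lvl e)! : ℝ) :=
        mul_le_mul_of_nonneg_left (by exact_mod_cast Nat.factorial_le hm) (by positivity)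

end Summit.Ventures.LatticeQCDFlow.TrivializingMaps

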